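import Summits.CriticalPhenomena.SAWScalingLimit.Theorems.SAWLoopFugacityFlowSimpleSubseqLimitsRouteResidual
import Summits.CriticalPhenomena.SAWScalingLimit.Theorems.SAWLoopFugacityFlowSimpleSubseqLimitsPSLine
import Summits.CriticalPhenomena.SAWScalingLimit.Theses.SAWStressTensor
import HarnessLib

/-!
# Birth skeleton of the SHAPE child `LimitRangeArc` of the ARC split of the crux `SimpleSubseqLimits`
# (stmt-CriticalPhenomena-4514; crux strategist session B, 2026-08-17)

The child (route-file text below, `LimitRangeArcText`; it IS the line vocabulary `PastShadowing.Main.RangeArc`,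
`text_iff_rangeArc`, `Iff.rfl`, and `ArcSplitEC.LimitRangeArc` of the landed glue): under every subsequential
weak limit `ν` of the critical SAW laws, `ν`-a.e. class has the RANGE of a simple arc from `a` to `b` meeting
`∂D` only at `a, b` — SHAPE, order-blind, value-free, and a CONSEQUENCE of the crux (`ArcSplitEC.rangeArc_of_core`).
On the observable routes wanting stmt-4514 (SAWExcursionCardy / SAWStressTensor / SAWQuadrupoleWard) nothing
route-native produces SHAPE: the martingale observable identifies the law only AFTER the subsequential limits are
parametrised. This skeleton records the child's two live plans ("a plan for both sides", BC2-redirect clause (d)):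

* VALUES ⇒ SHAPE (landed): `PastShadowing.Main.rangeArc_of_avoidanceValues : AvoidanceValues → RangeArc`, where
  `AvoidanceValues` (hull-avoidance values `Φ'_A(a)^{5/8}Φ'_A(b)^{5/8}` of every subsequential limit) is, verbatim,
  the SUPPORT item stmt-CriticalPhenomena-18170 `LimitAvoidanceValues` of route SAWLoopFugacityFlow — itself FREE
  given that route's A-side crux `AvoidanceLimit` (stmt-CriticalPhenomena-10649, staffed; lines under
  `Cruxes/AvoidanceLimit/`) by the landed `FarPast.RouteResidual.avoidanceValues_of_avoidanceLimit`.
* hence A-SIDE ⇒ SHAPE: `stub_avoidanceLimit → LimitRangeArcText` (`LimitRangeArc_of'`).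

Registered stubs (2; sorries ONLY here): `stub_limitAvoidanceValues : AvoidanceValues` (= stmt-18170, open),
`stub_avoidanceLimit : SAWLoopFugacityFlow.AvoidanceLimit` (= stmt-10649, open). Neither is the child reworded
(VALUES are strictly stronger than SHAPE and not implied by the crux; SHAPE is implied by the crux), neither gives
the crux (order-blind: the Z-fold witness `Negative.exists_simple_and_not_simple_same_range`, Disproof §7/§15) or
the summit conjunct on its own. A value-free engine for SHAPE (route SAWTensorRG: identification of the restriction
exponent `α = 5/8`; or a lattice near-enclosure bound + `BoundaryDecay`) would be a third plan; none is typed today.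
-/

noncomputable section

open MeasureTheory Filter Topology Set Metric Function
open Literature.Probability.RandomPlanarGeometry Literature.Probability.RandomPlanarGeometry.SAW
open Literature.Probability.LatticeModels
open scoped ENNReal NNReal BoundedContinuousFunction unitInterval

namespace Summit.CriticalPhenomena.SAWScalingLimit.Cruxes.SimpleSubseqLimits.RangeArcBirth

open Summit.CriticalPhenomena.SAWScalingLimit.Theorems.SimpleSubseqLimits.PastShadowing.Main
  (AvoidanceValues RangeArc rangeArc_of_avoidanceValues)
open Summit.CriticalPhenomena.SAWScalingLimit.Theorems.SimpleSubseqLimits.FarPast.RouteResidual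
  (avoidanceValues_of_avoidanceLimit)

/-- The route-file TEXT of the child `LimitRangeArc` (children.json of the ARC split; identical to the child
prepared for route SAWTensorRG by strategist s2). -/
def LimitRangeArcText : Prop :=
  (∀ (D : Literature.Probability.RandomPlanarGeometry.DobrushinDomain) (a b : ℝ → Literature.Probability.LatticeModels.Site 2), Literature.Probability.RandomPlanarGeometry.SAW.IsEndpointApprox D a b → ∀ (s : ℕ → ℝ) (ν : MeasureTheory.Measure (Literature.Probability.RandomPlanarGeometry.CurveClass ℂ)), Filter.Tendsto s Filter.atTop (nhdsWithin 0 (Set.Ioi 0)) → MeasureTheory.IsProbabilityMeasure ν → (∀ f : BoundedContinuousFunction (Literature.Probability.RandomPlanarGeometry.CurveClass ℂ) ℝ, Filter.Tendsto (fun n => ∫ γ, f γ.curve ∂(Literature.Probability.RandomPlanarGeometry.SAW.law D.carrier (s n) (a (s n)) (b (s n)))) Filter.atTop (nhds (∫ x, f x ∂ν))) → ∀ᵐ γ ∂ν, (∃ e : C(unitInterval, ℂ), Function.Injective e ∧ Set.range e = γ.range ∧ e 0 = D.pt 0 ∧ e 1 = D.pt 1) ∧ γ.range ∩ frontier D.carrier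 ⊆ {D.pt 0, D.pt 1})

/-- The child text IS the line vocabulary `PastShadowing.Main.RangeArc` (definitional). [folklore] -/
theorem text_iff_rangeArc : LimitRangeArcText ↔ RangeArc :=
  Iff.rfl

/-! ## Registered stubs -/

/-- STUB 1 — VALUES: hull-avoidance values of subsequential limits (= item stmt-CriticalPhenomena-18170,
support on SAWLoopFugacityFlow; open; free given stmt-10649). -/
theorem stub_limitAvoidanceValues : AvoidanceValues := by
  sorry

/-- STUB 2 — the valued A-side itself (= crux stmt-CriticalPhenomena-10649 `AvoidanceLimit` of route
SAWLoopFugacityFlow, by name; open, staffed). -/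
theorem stub_avoidanceLimit :
    Summit.CriticalPhenomena.SAWScalingLimit.Theses.SAWLoopFugacityFlow.AvoidanceLimit := by
  sorry

/-! ## Compositions (kernel-checked) -/

/-- **COMPOSITION (VALUES ⇒ SHAPE)**: the child from stub 1 through the landed
`rangeArc_of_avoidanceValues`. [folklore] -/
theorem LimitRangeArc_of : AvoidanceValues → LimitRangeArcText :=
  fun h => text_iff_rangeArc.2 (rangeArc_of_avoidanceValues h)

/-- **COMPOSITION (A-SIDE ⇒ SHAPE)**: the child from stub 2 through the landed
`avoidanceValues_of_avoidanceLimit` and `rangeArc_of_avoidanceValues`. [folklore] -/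
theorem LimitRangeArc_of' :
    Summit.CriticalPhenomena.SAWScalingLimit.Theses.SAWLoopFugacityFlow.AvoidanceLimit → LimitRangeArcText :=
  fun h => LimitRangeArc_of (avoidanceValues_of_avoidanceLimit h)

/-- Wiring check (VALUES path). -/
theorem LimitRangeArc_proof : LimitRangeArcText :=
  LimitRangeArc_of stub_limitAvoidanceValues

/-- Wiring check (A-side path). -/
theorem LimitRangeArc_proof' : LimitRangeArcText :=
  LimitRangeArc_of' stub_avoidanceLimit

/-! ## The child BY NAME on route SAWStressTensor (item stmt-CriticalPhenomena-18399, ARC split of stmt-4514, rev 4) -/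

/-- The child decl `SAWStressTensor.LimitRangeArc` IS `PastShadowing.Main.RangeArc` (definitional). [folklore] -/
theorem child_iff_rangeArc :
    Summit.CriticalPhenomena.SAWScalingLimit.Theses.SAWStressTensor.LimitRangeArc ↔ RangeArc :=
  Iff.rfl

/-- **COMPOSITION for stmt-CriticalPhenomena-18399 (VALUES ⇒ SHAPE), BY NAME.** [folklore] -/
theorem LimitRangeArcST_of :
    AvoidanceValues → Summit.CriticalPhenomena.SAWScalingLimit.Theses.SAWStressTensor.LimitRangeArc :=
  fun h => child_iff_rangeArc.2 (rangeArc_of_avoidanceValues h)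

/-- **COMPOSITION for stmt-CriticalPhenomena-18399 (A-SIDE ⇒ SHAPE), BY NAME.** [folklore] -/
theorem LimitRangeArcST_of' :
    Summit.CriticalPhenomena.SAWScalingLimit.Theses.SAWLoopFugacityFlow.AvoidanceLimit →
      Summit.CriticalPhenomena.SAWScalingLimit.Theses.SAWStressTensor.LimitRangeArc :=
  fun h => LimitRangeArcST_of (avoidanceValues_of_avoidanceLimit h)

/-- Wiring check for stmt-18399 (VALUES path). -/
theorem LimitRangeArcST_proof :
    Summit.CriticalPhenomena.SAWScalingLimit.Theses.SAWStressTensor.LimitRangeArc :=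
  LimitRangeArcST_of stub_limitAvoidanceValues

end Summit.CriticalPhenomena.SAWScalingLimit.Cruxes.SimpleSubseqLimits.RangeArcBirth

end
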